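import Summits.Ventures.Crystal3D.Theorems.StickyWulffConstantCoaxialWallLawTwinContactsCoreA
import Summits.Ventures.Crystal3D.Theorems.StickyWulffConstantCoaxialWallLawTwinContactsCoreB
import Summits.Ventures.Crystal3D.Theorems.StickyWulffConstantCoaxialWallLawTwinContactsCoreC
import Summits.Ventures.Crystal3D.Theorems.StickyWulffConstantCoaxialWallLawTwinContactsCoreD
import Summits.Ventures.Crystal3D.Theorems.StickyWulffConstantCoaxialWallLawTwinCageLocal
import HarnessLib

/-!
# Foreign contacts at a TWIN (hcp) host touch AT MOST TWO dozen members, and two only if these are ADJACENT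
# (crux `CoaxialWallLaw`, stmt-Ventures-19481, line `WallLedgerF`; census-free brick T2 for the OFF-MODULE tail)

HONEST FRAMING. Venture `Summits/Ventures/Crystal3D` (cell `crystal3d-full`), helper `--supports` the crux
`CoaxialWallLaw` (stmt-Ventures-19481, `route-Ventures-StickyWulffConstant`), REGISTERED line `WallLedgerF` (planner
cf-p1, (lxxiv)(4) «T2 GO»).  Rung credit; F-C1 not moved; census-free.  Twin-host companion of
`…CoaxialWallLawForeignContacts` (fcc hosts); cells `…TwinContactsCoreA–D`; machinery of `…TwinCage(Local)`.

The TWIN DOZEN of the frame `G` and menu normal `m` is `D = {G w : ⟪G w, m⟫ ≤ 0} ∪ {G w − 2⟪G w, m⟫ m : ⟪G w, m⟫ < 0}`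
(the contact dozen of a twin reader / of an hcp-type host).  For a unit `t` (read `t = x − y`, `x` a ball touching
the host `y`), a CONTACT member is `d ∈ D` with `⟪t, d⟫ = ½` (`dist x (y + d) = 1`).
* `twin_two_contacts_core`, `twin_three_contacts_core` — assembly of the cells (signed cubic coordinates);
* `twin_member_pack` — a member's table entry, its contact functional and its own coordinates;
* **`twin_two_contacts`** — two distinct contact members ⇒ `t ∈ D`, OR the two members are ADJACENT (`⟪d₁, d₂⟫ = ½`:
  `t` is an apex of the triangle `{0, d₁, d₂}` — `24` such foreign positions) and they are the ONLY contact members;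
* **`mem_twinDozen_of_three_contacts`**, **`card_twinContacts_le_two`** — three contact members force `t ∈ D`; an
  off-dozen unit vector has at most two contact members;
* configuration level: **`foreign_contact_twinDozen_contacts_le_two`**, **`foreign_contact_twinDozen_adjacent`** — a ball
  `x` touching `y` off `y + D` touches at most two of the twelve positions `y + d`, and two only if they are adjacent.
WHAT THIS IS NOT: not the tail; F-C1 not moved.
-/

noncomputable section

namespace Summit.Ventures.Crystal3D.Theorems

open Summit.Ventures.Crystal3D Finset NearIdentity
open scoped InnerProductSpace

/-! ### Assembly of the cells -/

/-- **Two-contact core at a twin host** (signed cubic coordinates, table scaled by `3`). -/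
theorem twin_two_contacts_core (x : Fin 3 → ℝ) (hn : x 0 ^ 2 + x 1 ^ 2 + x 2 ^ 2 = 2) (a₁ b₁ c₁ a₂ b₂ c₂ : ℤ)
    (h₁mem : (a₁, b₁, c₁) ∈ ({(3, -3, 0), (-3, 3, 0), (-3, -3, 0), (3, 0, -3), (-3, 0, 3), (-3, 0, -3), (0, 3, -3), (0, -3, 3), (0, -3, -3), (1, 1, 4), (1, 4, 1), (4, 1, 1)} : Finset (ℤ × ℤ × ℤ)))
    (h₂mem : (a₂, b₂, c₂) ∈ ({(3, -3, 0), (-3, 3, 0), (-3, -3, 0), (3, 0, -3), (-3, 0, 3), (-3, 0, -3), (0, 3, -3), (0, -3, 3), (0, -3, -3), (1, 1, 4), (1, 4, 1), (4, 1, 1)} : Finset (ℤ × ℤ × ℤ)))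
    (hne : (a₂, b₂, c₂) ≠ (a₁, b₁, c₁)) (h₁ : x 0 * a₁ + x 1 * b₁ + x 2 * c₁ = 3) (h₂ : x 0 * a₂ + x 1 * b₂ + x 2 * c₂ = 3) :
    (∃ τ ∈ ({(3, -3, 0), (-3, 3, 0), (-3, -3, 0), (3, 0, -3), (-3, 0, 3), (-3, 0, -3), (0, 3, -3), (0, -3, 3), (0, -3, -3), (1, 1, 4), (1, 4, 1), (4, 1, 1)} : Finset (ℤ × ℤ × ℤ)),
      3 * x 0 = τ.1 ∧ 3 * x 1 = τ.2.1 ∧ 3 * x 2 = τ.2.2) ∨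
    (a₁ * a₂ + b₁ * b₂ + c₁ * c₂ = 9 ∧ ∀ τ ∈ ({(3, -3, 0), (-3, 3, 0), (-3, -3, 0), (3, 0, -3), (-3, 0, 3), (-3, 0, -3), (0, 3, -3), (0, -3, 3), (0, -3, -3), (1, 1, 4), (1, 4, 1), (4, 1, 1)} : Finset (ℤ × ℤ × ℤ)),
      x 0 * τ.1 + x 1 * τ.2.1 + x 2 * τ.2.2 = 3 → τ = (a₁, b₁, c₁) ∨ τ = (a₂, b₂, c₂)) := by
  simp only [Finset.mem_insert, Finset.mem_singleton] at h₁mem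
  rcases h₁mem with ⟨rfl, rfl, rfl⟩ | ⟨rfl, rfl, rfl⟩ | ⟨rfl, rfl, rfl⟩ | ⟨rfl, rfl, rfl⟩ | ⟨rfl, rfl, rfl⟩ | ⟨rfl, rfl, rfl⟩ | ⟨rfl, rfl, rfl⟩ | ⟨rfl, rfl, rfl⟩ | ⟨rfl, rfl, rfl⟩ | ⟨rfl, rfl, rfl⟩ | ⟨rfl, rfl, rfl⟩ | ⟨rfl, rfl, rfl⟩
  · exact twin_contacts_from_0 x hn a₂ b₂ c₂ h₂mem hne (by push_cast at h₁; linarith) h₂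
  · exact twin_contacts_from_1 x hn a₂ b₂ c₂ h₂mem hne (by push_cast at h₁; linarith) h₂
  · exact twin_contacts_from_2 x hn a₂ b₂ c₂ h₂mem hne (by push_cast at h₁; linarith) h₂
  · exact twin_contacts_from_3 x hn a₂ b₂ c₂ h₂mem hne (by push_cast at h₁; linarith) h₂
  · exact twin_contacts_from_4 x hn a₂ b₂ c₂ h₂mem hne (by push_cast at h₁; linarith) h₂
  · exact twin_contacts_from_5 x hn a₂ b₂ c₂ h₂mem hne (by push_cast at h₁; linarith) h₂
  · exact twin_contacts_from_6 x hn a₂ b₂ c₂ h₂mem hne (by push_cast at h₁; linarith) h₂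
  · exact twin_contacts_from_7 x hn a₂ b₂ c₂ h₂mem hne (by push_cast at h₁; linarith) h₂
  · exact twin_contacts_from_8 x hn a₂ b₂ c₂ h₂mem hne (by push_cast at h₁; linarith) h₂
  · exact twin_contacts_from_9 x hn a₂ b₂ c₂ h₂mem hne (by push_cast at h₁; linarith) h₂
  · exact twin_contacts_from_10 x hn a₂ b₂ c₂ h₂mem hne (by push_cast at h₁; linarith) h₂
  · exact twin_contacts_from_11 x hn a₂ b₂ c₂ h₂mem hne (by push_cast at h₁; linarith) h₂

/-- **Three-contact core at a twin host**: three distinct contact entries force `3x` into the table. -/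
theorem twin_three_contacts_core (x : Fin 3 → ℝ) (hn : x 0 ^ 2 + x 1 ^ 2 + x 2 ^ 2 = 2)
    (a₁ b₁ c₁ a₂ b₂ c₂ a₃ b₃ c₃ : ℤ)
    (h₁mem : (a₁, b₁, c₁) ∈ ({(3, -3, 0), (-3, 3, 0), (-3, -3, 0), (3, 0, -3), (-3, 0, 3), (-3, 0, -3), (0, 3, -3), (0, -3, 3), (0, -3, -3), (1, 1, 4), (1, 4, 1), (4, 1, 1)} : Finset (ℤ × ℤ × ℤ)))
    (h₂mem : (a₂, b₂, c₂) ∈ ({(3, -3, 0), (-3, 3, 0), (-3, -3, 0), (3, 0, -3), (-3, 0, 3), (-3, 0, -3), (0, 3, -3), (0, -3, 3), (0, -3, -3), (1, 1, 4), (1, 4, 1), (4, 1, 1)} : Finset (ℤ × ℤ × ℤ)))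
    (h₃mem : (a₃, b₃, c₃) ∈ ({(3, -3, 0), (-3, 3, 0), (-3, -3, 0), (3, 0, -3), (-3, 0, 3), (-3, 0, -3), (0, 3, -3), (0, -3, 3), (0, -3, -3), (1, 1, 4), (1, 4, 1), (4, 1, 1)} : Finset (ℤ × ℤ × ℤ)))
    (h₁₂ : (a₂, b₂, c₂) ≠ (a₁, b₁, c₁)) (h₁₃ : (a₃, b₃, c₃) ≠ (a₁, b₁, c₁)) (h₂₃ : (a₃, b₃, c₃) ≠ (a₂, b₂, c₂))
    (h₁ : x 0 * a₁ + x 1 * b₁ + x 2 * c₁ = 3) (h₂ : x 0 * a₂ + x 1 * b₂ + x 2 * c₂ = 3)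
    (h₃ : x 0 * a₃ + x 1 * b₃ + x 2 * c₃ = 3) :
    ∃ τ ∈ ({(3, -3, 0), (-3, 3, 0), (-3, -3, 0), (3, 0, -3), (-3, 0, 3), (-3, 0, -3), (0, 3, -3), (0, -3, 3), (0, -3, -3), (1, 1, 4), (1, 4, 1), (4, 1, 1)} : Finset (ℤ × ℤ × ℤ)),
      3 * x 0 = τ.1 ∧ 3 * x 1 = τ.2.1 ∧ 3 * x 2 = τ.2.2 := by
  rcases twin_two_contacts_core x hn a₁ b₁ c₁ a₂ b₂ c₂ h₁mem h₂mem h₁₂ h₁ h₂ with h | ⟨-, hex⟩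
  · exact h
  · rcases hex _ h₃mem h₃ with e | e
    · exact absurd e h₁₃
    · exact absurd e h₂₃

/-! ### Geometry -/

section Geometry

variable (G : EuclideanSpace ℝ (Fin 3) ≃ₗᵢ[ℝ] EuclideanSpace ℝ (Fin 3)) {m : EuclideanSpace ℝ (Fin 3)} {c : Fin 8}

/-- The signed cubic coordinates of a slot member `G sₗ` are `sₗ c` (`3x = 3 sₗ c`). -/
theorem twin_coords_slot (c : Fin 8) (l : Fin 12) (i : Fin 3) :
    3 * (Real.sqrt 2 * cubeInt c i * cubicCoords (G.symm (G (slotSite l))) i) = ((3 * (slotInt l i * cubeInt c i) : ℤ) : ℝ) := by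
  rw [G.symm_apply_apply, cubicCoords_slotSite]
  have h2 : Real.sqrt 2 ≠ 0 := by positivity
  simp only [slotVec]
  push_cast
  field_simp

/-- The signed cubic coordinates of a mirror member `G sₗ − 2⟪G sₗ, m⟫ m` (`sₗ·c = −2`) are `(3 sₗ c + 4)/3`. -/
theorem twin_coords_mirror (hc : cubicCoords (G.symm m) = fun j => (cubeInt c j : ℝ) / Real.sqrt 3) (l : Fin 12)
    (hsum : sdot3 (slotInt l) (cubeInt c) = -2) (i : Fin 3) :
    3 * (Real.sqrt 2 * cubeInt c i * cubicCoords (G.symm (G (slotSite l) - (2 * ⟪G (slotSite l), m⟫_ℝ) • m)) i) =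
      ((3 * (slotInt l i * cubeInt c i) + 4 : ℤ) : ℝ) := by
  have h2p : 0 < Real.sqrt 2 := Real.sqrt_pos.2 (by norm_num)
  have h3p : 0 < Real.sqrt 3 := Real.sqrt_pos.2 (by norm_num)
  have h22 : Real.sqrt 2 ^ 2 = 2 := Real.sq_sqrt (by norm_num)
  have h33 : Real.sqrt 3 ^ 2 = 3 := Real.sq_sqrt (by norm_num)
  have h6 : Real.sqrt 6 = Real.sqrt 2 * Real.sqrt 3 := by
    rw [← Real.sqrt_mul (by norm_num : (0 : ℝ) ≤ 2) 3]; norm_num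
  have hc2 : ((cubeInt c i : ℤ) : ℝ) * (cubeInt c i : ℤ) = 1 := by
    rcases cubeInt_pm_one c i with h | h <;> simp [h]
  rw [map_sub, LinearIsometryEquiv.map_smul, G.symm_apply_apply, cubicCoords_sub, cubicCoords_smul, cubicCoords_slotSite,
    hc, inner_map_slotSite_menu hc l, hsum]
  simp only [slotVec, Pi.sub_apply, Pi.smul_apply, smul_eq_mul, h6]
  push_cast
  field_simp
  rw [h33]
  linear_combination (12 : ℝ) * hc2

/-- **Member package.**  A member `d` of the twin dozen has a table entry `τ` (scaled by `3`) such that, in signed cubic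
coordinates, `x(t)·τ = 6⟪t, d⟫` for every `t` and `3 x(d) = τ`. -/
theorem twin_member_pack (hc : cubicCoords (G.symm m) = fun j => (cubeInt c j : ℝ) / Real.sqrt 3)
    {d : EuclideanSpace ℝ (Fin 3)} (hd : d ∈ ((fccSlots.filter fun w => ⟪G w, m⟫_ℝ ≤ 0).image fun w => G w) ∪
        ((fccSlots.filter fun w => ⟪G w, m⟫_ℝ < 0).image fun w => G w - (2 * ⟪G w, m⟫_ℝ) • m)) :
    ∃ τ ∈ ({(3, -3, 0), (-3, 3, 0), (-3, -3, 0), (3, 0, -3), (-3, 0, 3), (-3, 0, -3), (0, 3, -3), (0, -3, 3), (0, -3, -3), (1, 1, 4), (1, 4, 1), (4, 1, 1)} : Finset (ℤ × ℤ × ℤ)),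
      (∀ t : EuclideanSpace ℝ (Fin 3),
        Real.sqrt 2 * cubeInt c 0 * cubicCoords (G.symm t) 0 * τ.1 + Real.sqrt 2 * cubeInt c 1 * cubicCoords (G.symm t) 1 * τ.2.1 +
          Real.sqrt 2 * cubeInt c 2 * cubicCoords (G.symm t) 2 * τ.2.2 = 6 * ⟪t, d⟫_ℝ) ∧
      (3 * (Real.sqrt 2 * cubeInt c 0 * cubicCoords (G.symm d) 0) = τ.1 ∧
        3 * (Real.sqrt 2 * cubeInt c 1 * cubicCoords (G.symm d) 1) = τ.2.1 ∧
        3 * (Real.sqrt 2 * cubeInt c 2 * cubicCoords (G.symm d) 2) = τ.2.2) := by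
  classical
  rcases (mem_twinDozenVec_iff G m d).1 hd with ⟨w, hw, hle, rfl⟩ | ⟨w, hw, hlt, rfl⟩
  · obtain ⟨l, rfl⟩ := exists_slotSite_eq hw
    have hsum := (twin_sgn_mem G hc l).1.1 hle
    refine ⟨_, twin_table_slot c l hsum, fun t => ?_, ?_, ?_, ?_⟩
    · have := twin_slot_eq G c t l; simpa using this
    · simpa using twin_coords_slot G c l 0
    · simpa using twin_coords_slot G c l 1
    · simpa using twin_coords_slot G c l 2
  · obtain ⟨l, rfl⟩ := exists_slotSite_eq hw
    have hsum := (twin_sgn_mem G hc l).2.1.1 hlt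
    refine ⟨_, twin_table_mirror c l hsum, fun t => ?_, ?_, ?_, ?_⟩
    · have := twin_mirror_eq hc t l hsum; simpa using this
    · simpa using twin_coords_mirror G hc l hsum 0
    · simpa using twin_coords_mirror G hc l hsum 1
    · simpa using twin_coords_mirror G hc l hsum 2

/-- A vector is determined by its inner products. -/
theorem eq_of_forall_inner_eq {d d' : EuclideanSpace ℝ (Fin 3)} (h : ∀ t : EuclideanSpace ℝ (Fin 3), ⟪t, d⟫_ℝ = ⟪t, d'⟫_ℝ) :
    d = d' := by
  have h0 : ⟪d - d', d - d'⟫_ℝ = 0 := by rw [inner_sub_right, h (d - d'), sub_self]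
  exact sub_eq_zero.1 (inner_self_eq_zero.1 h0)

/-- **TWO CONTACT MEMBERS: on the dozen, or an apex over an adjacent pair.**  For a frame `G`, menu normal `m`, unit
`t` and two distinct members `d₁ ≠ d₂` of the twin dozen with `⟪t, d₁⟫ = ⟪t, d₂⟫ = ½`: either `t` is itself a member,
or `⟪d₁, d₂⟫ = ½` and `d₁, d₂` are the only contact members of `t`. -/
theorem twin_two_contacts (hm : IsMenuNormal G m) {t : EuclideanSpace ℝ (Fin 3)} (ht : ‖t‖ = 1)
    {d₁ d₂ : EuclideanSpace ℝ (Fin 3)}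
    (hd₁ : d₁ ∈ ((fccSlots.filter fun w => ⟪G w, m⟫_ℝ ≤ 0).image fun w => G w) ∪
        ((fccSlots.filter fun w => ⟪G w, m⟫_ℝ < 0).image fun w => G w - (2 * ⟪G w, m⟫_ℝ) • m))
    (hd₂ : d₂ ∈ ((fccSlots.filter fun w => ⟪G w, m⟫_ℝ ≤ 0).image fun w => G w) ∪
        ((fccSlots.filter fun w => ⟪G w, m⟫_ℝ < 0).image fun w => G w - (2 * ⟪G w, m⟫_ℝ) • m))
    (hne : d₁ ≠ d₂) (h₁ : ⟪t, d₁⟫_ℝ = 1 / 2) (h₂ : ⟪t, d₂⟫_ℝ = 1 / 2) :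
    t ∈ ((fccSlots.filter fun w => ⟪G w, m⟫_ℝ ≤ 0).image fun w => G w) ∪
        ((fccSlots.filter fun w => ⟪G w, m⟫_ℝ < 0).image fun w => G w - (2 * ⟪G w, m⟫_ℝ) • m) ∨
    (⟪d₁, d₂⟫_ℝ = 1 / 2 ∧ ∀ d ∈ ((fccSlots.filter fun w => ⟪G w, m⟫_ℝ ≤ 0).image fun w => G w) ∪
        ((fccSlots.filter fun w => ⟪G w, m⟫_ℝ < 0).image fun w => G w - (2 * ⟪G w, m⟫_ℝ) • m),
        ⟪t, d⟫_ℝ = 1 / 2 → d = d₁ ∨ d = d₂) := by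
  classical
  obtain ⟨c, hc⟩ := exists_cubeInt_of_menu_normal G hm.1 hm.2
  have hs1 : ‖G.symm t‖ = 1 := by rw [LinearIsometryEquiv.norm_map, ht]
  have hn := twin_x_sq c hs1
  set x : Fin 3 → ℝ := fun i => Real.sqrt 2 * cubeInt c i * cubicCoords (G.symm t) i with hx
  obtain ⟨τ₁, hτ₁, hid₁, e₁⟩ := twin_member_pack G hc hd₁
  obtain ⟨τ₂, hτ₂, hid₂, e₂⟩ := twin_member_pack G hc hd₂
  obtain ⟨a₁, b₁, c₁⟩ := τ₁
  obtain ⟨a₂, b₂, c₂⟩ := τ₂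
  simp only at hid₁ hid₂ e₁ e₂
  have hne' : ((a₂, b₂, c₂) : ℤ × ℤ × ℤ) ≠ (a₁, b₁, c₁) := by
    intro h
    simp only [Prod.mk.injEq] at h
    obtain ⟨rfl, rfl, rfl⟩ := h
    exact hne (eq_of_forall_inner_eq fun t' => by linarith [hid₁ t', hid₂ t'])
  have hx₁ : x 0 * a₁ + x 1 * b₁ + x 2 * c₁ = 3 := by have := hid₁ t; simp only [hx]; linarith
  have hx₂ : x 0 * a₂ + x 1 * b₂ + x 2 * c₂ = 3 := by have := hid₂ t; simp only [hx]; linarith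
  rcases twin_two_contacts_core x hn a₁ b₁ c₁ a₂ b₂ c₂ hτ₁ hτ₂ hne' hx₁ hx₂ with ⟨τ, hτ, f0, f1, f2⟩ | ⟨h9, hex⟩
  · left
    rcases twin_table_cover c τ hτ with ⟨l, hl, rfl⟩ | ⟨l, hl, rfl⟩
    · rw [eq_slot_of_twin_coords G c l (t := t) fun i => by fin_cases i <;> assumption]
      exact (twin_sgn_mem G hc l).2.2.1 hl
    · rw [eq_mirror_of_twin_coords hc l hl (t := t) fun i => by fin_cases i <;> assumption]
      exact (twin_sgn_mem G hc l).2.2.2 hl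
  · right
    refine ⟨?_, fun d hd hcd => ?_⟩
    · -- `⟪d₁, d₂⟫ = ½` from `x(d₂)·τ₁ = 6⟪d₂, d₁⟫` and `3 x(d₂) = τ₂`, `τ₁·τ₂ = 9`
      have h := hid₁ d₂
      obtain ⟨g0, g1, g2⟩ := e₂
      have h9' : ((a₁ : ℝ) * a₂ + b₁ * b₂ + c₁ * c₂) = 9 := by exact_mod_cast h9
      rw [real_inner_comm] at h
      linear_combination (-1 / 6 : ℝ) * h + ((a₁ : ℝ) / 18) * g0 + ((b₁ : ℝ) / 18) * g1 + ((c₁ : ℝ) / 18) * g2 +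
        (1 / 18 : ℝ) * h9'
    · obtain ⟨τ, hτ, hid, -⟩ := twin_member_pack G hc hd
      have hxτ : x 0 * τ.1 + x 1 * τ.2.1 + x 2 * τ.2.2 = 3 := by have := hid t; simp only [hx]; linarith
      rcases hex τ hτ hxτ with rfl | rfl
      · exact Or.inl (eq_of_forall_inner_eq fun t' => by have := hid t'; have := hid₁ t'; simp only at *; linarith)
      · exact Or.inr (eq_of_forall_inner_eq fun t' => by have := hid t'; have := hid₂ t'; simp only at *; linarith)

/-- **Three contact members force the dozen.** -/
theorem mem_twinDozen_of_three_contacts (hm : IsMenuNormal G m) {t : EuclideanSpace ℝ (Fin 3)} (ht : ‖t‖ = 1)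
    {d₁ d₂ d₃ : EuclideanSpace ℝ (Fin 3)}
    (hd₁ : d₁ ∈ ((fccSlots.filter fun w => ⟪G w, m⟫_ℝ ≤ 0).image fun w => G w) ∪
        ((fccSlots.filter fun w => ⟪G w, m⟫_ℝ < 0).image fun w => G w - (2 * ⟪G w, m⟫_ℝ) • m))
    (hd₂ : d₂ ∈ ((fccSlots.filter fun w => ⟪G w, m⟫_ℝ ≤ 0).image fun w => G w) ∪
        ((fccSlots.filter fun w => ⟪G w, m⟫_ℝ < 0).image fun w => G w - (2 * ⟪G w, m⟫_ℝ) • m))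
    (hd₃ : d₃ ∈ ((fccSlots.filter fun w => ⟪G w, m⟫_ℝ ≤ 0).image fun w => G w) ∪
        ((fccSlots.filter fun w => ⟪G w, m⟫_ℝ < 0).image fun w => G w - (2 * ⟪G w, m⟫_ℝ) • m))
    (h₁₂ : d₁ ≠ d₂) (h₁₃ : d₁ ≠ d₃) (h₂₃ : d₂ ≠ d₃)
    (h₁ : ⟪t, d₁⟫_ℝ = 1 / 2) (h₂ : ⟪t, d₂⟫_ℝ = 1 / 2) (h₃ : ⟪t, d₃⟫_ℝ = 1 / 2) :
    t ∈ ((fccSlots.filter fun w => ⟪G w, m⟫_ℝ ≤ 0).image fun w => G w) ∪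
        ((fccSlots.filter fun w => ⟪G w, m⟫_ℝ < 0).image fun w => G w - (2 * ⟪G w, m⟫_ℝ) • m) := by
  rcases twin_two_contacts G hm ht hd₁ hd₂ h₁₂ h₁ h₂ with h | ⟨-, hex⟩
  · exact h
  · rcases hex d₃ hd₃ h₃ with e | e
    · exact absurd e.symm h₁₃
    · exact absurd e.symm h₂₃

open scoped Classical in
/-- **An off-dozen unit vector has at most two contact members.** -/
theorem card_twinContacts_le_two (hm : IsMenuNormal G m) {t : EuclideanSpace ℝ (Fin 3)} (ht : ‖t‖ = 1)
    (hoff : t ∉ ((fccSlots.filter fun w => ⟪G w, m⟫_ℝ ≤ 0).image fun w => G w) ∪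
        ((fccSlots.filter fun w => ⟪G w, m⟫_ℝ < 0).image fun w => G w - (2 * ⟪G w, m⟫_ℝ) • m)) :
    ((((fccSlots.filter fun w => ⟪G w, m⟫_ℝ ≤ 0).image fun w => G w) ∪
        ((fccSlots.filter fun w => ⟪G w, m⟫_ℝ < 0).image fun w => G w - (2 * ⟪G w, m⟫_ℝ) • m)).filter
      fun d => ⟪t, d⟫_ℝ = 1 / 2).card ≤ 2 := by
  by_contra hlt
  push Not at hlt
  obtain ⟨a, ha, b, hb, b', hb', hab, hab', hbb'⟩ := Finset.two_lt_card.1 hlt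
  rw [mem_filter] at ha hb hb'
  exact hoff (mem_twinDozen_of_three_contacts G hm ht ha.1 hb.1 hb'.1 hab hab' hbb' ha.2 hb.2 hb'.2)

/-! ### Configuration level -/

/-- A ball `x` touching `y` touches the member position `y + d` iff `⟪x − y, d⟫ = ½`. -/
theorem dist_twinMember_eq_one_iff (hm : ‖m‖ = 1) {x y d : EuclideanSpace ℝ (Fin 3)} (hxy : dist x y = 1)
    (hd : d ∈ ((fccSlots.filter fun w => ⟪G w, m⟫_ℝ ≤ 0).image fun w => G w) ∪
        ((fccSlots.filter fun w => ⟪G w, m⟫_ℝ < 0).image fun w => G w - (2 * ⟪G w, m⟫_ℝ) • m)) :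
    dist x (y + d) = 1 ↔ ⟪x - y, d⟫_ℝ = 1 / 2 := by
  have ht : ‖x - y‖ = 1 := by rwa [← dist_eq_norm]
  have hdn : ‖d‖ = 1 := norm_eq_one_of_mem_twinDozen G hm hd
  have hd' : dist x (y + d) = ‖x - y - d‖ := by rw [dist_eq_norm]; congr 1; abel
  have hsq : ‖x - y - d‖ ^ 2 = 2 - 2 * ⟪x - y, d⟫_ℝ := by rw [norm_sub_sq_real, ht, hdn]; ring
  rw [hd']
  constructor
  · intro h; rw [h] at hsq; linarith
  · intro h
    rw [h] at hsq
    have h1 : ‖x - y - d‖ ^ 2 = 1 ^ 2 := by rw [hsq]; norm_num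
    exact (sq_eq_sq₀ (norm_nonneg _) zero_le_one).1 h1

open scoped Classical in
/-- **A foreign contact at a twin host touches at most two dozen members of the host.** -/
theorem foreign_contact_twinDozen_contacts_le_two (hm : IsMenuNormal G m) {x y : EuclideanSpace ℝ (Fin 3)}
    (hxy : dist x y = 1) (hoff : ∀ d ∈ ((fccSlots.filter fun w => ⟪G w, m⟫_ℝ ≤ 0).image fun w => G w) ∪
        ((fccSlots.filter fun w => ⟪G w, m⟫_ℝ < 0).image fun w => G w - (2 * ⟪G w, m⟫_ℝ) • m), x ≠ y + d) :
    ((((fccSlots.filter fun w => ⟪G w, m⟫_ℝ ≤ 0).image fun w => G w) ∪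
        ((fccSlots.filter fun w => ⟪G w, m⟫_ℝ < 0).image fun w => G w - (2 * ⟪G w, m⟫_ℝ) • m)).filter
      fun d => dist x (y + d) = 1).card ≤ 2 := by
  have ht : ‖x - y‖ = 1 := by rwa [← dist_eq_norm]
  have hoff' : x - y ∉ ((fccSlots.filter fun w => ⟪G w, m⟫_ℝ ≤ 0).image fun w => G w) ∪
        ((fccSlots.filter fun w => ⟪G w, m⟫_ℝ < 0).image fun w => G w - (2 * ⟪G w, m⟫_ℝ) • m) :=
    fun h => hoff _ h (by abel)
  rw [filter_congr fun d hd => dist_twinMember_eq_one_iff G hm.1 hxy hd]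
  exact card_twinContacts_le_two G hm ht hoff'

/-- **Two member contacts of a foreign ball are adjacent** (so the ball is an apex over the triangle
`{y, y + d₁, y + d₂}`), and they are its only member contacts. -/
theorem foreign_contact_twinDozen_adjacent (hm : IsMenuNormal G m) {x y : EuclideanSpace ℝ (Fin 3)}
    (hxy : dist x y = 1) (hoff : ∀ d ∈ ((fccSlots.filter fun w => ⟪G w, m⟫_ℝ ≤ 0).image fun w => G w) ∪
        ((fccSlots.filter fun w => ⟪G w, m⟫_ℝ < 0).image fun w => G w - (2 * ⟪G w, m⟫_ℝ) • m), x ≠ y + d)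
    {d₁ d₂ : EuclideanSpace ℝ (Fin 3)}
    (hd₁ : d₁ ∈ ((fccSlots.filter fun w => ⟪G w, m⟫_ℝ ≤ 0).image fun w => G w) ∪
        ((fccSlots.filter fun w => ⟪G w, m⟫_ℝ < 0).image fun w => G w - (2 * ⟪G w, m⟫_ℝ) • m))
    (hd₂ : d₂ ∈ ((fccSlots.filter fun w => ⟪G w, m⟫_ℝ ≤ 0).image fun w => G w) ∪
        ((fccSlots.filter fun w => ⟪G w, m⟫_ℝ < 0).image fun w => G w - (2 * ⟪G w, m⟫_ℝ) • m))
    (hne : d₁ ≠ d₂) (h₁ : dist x (y + d₁) = 1) (h₂ : dist x (y + d₂) = 1) :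
    ⟪d₁, d₂⟫_ℝ = 1 / 2 ∧ ∀ d ∈ ((fccSlots.filter fun w => ⟪G w, m⟫_ℝ ≤ 0).image fun w => G w) ∪
        ((fccSlots.filter fun w => ⟪G w, m⟫_ℝ < 0).image fun w => G w - (2 * ⟪G w, m⟫_ℝ) • m),
        dist x (y + d) = 1 → d = d₁ ∨ d = d₂ := by
  have ht : ‖x - y‖ = 1 := by rwa [← dist_eq_norm]
  rcases twin_two_contacts G hm ht hd₁ hd₂ hne ((dist_twinMember_eq_one_iff G hm.1 hxy hd₁).1 h₁)
      ((dist_twinMember_eq_one_iff G hm.1 hxy hd₂).1 h₂) with h | ⟨hadj, hex⟩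
  · exact absurd (by abel : x = y + (x - y)) (hoff _ h)
  · exact ⟨hadj, fun d hd hcd => hex d hd ((dist_twinMember_eq_one_iff G hm.1 hxy hd).1 hcd)⟩

end Geometry

end Summit.Ventures.Crystal3D.Theorems

end
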